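import Summits.BirchSwinnertonDyer.Rank1Residual.WAll.Conjunction
import Summits.BirchSwinnertonDyer.Rank1Residual.Additive.PotSupersingularTargets
import HarnessLib
import HarnessLib.Audit.Tags

/-!
# Rung W-ALL of ladder BSD (D-0120) — row 2 (additive primes) of the closed list REFINED along the
# tree's five-cell sub-partition of the odd additive locus (cell `bsd-wall`, lane (2), seat `bsd-wall-ty-1`)

HONEST FRAMING (cell `bsd-wall`, run/shared/lean/pub/bsd-wall/; brief `WALL-BRIEF-v1.md` sha16
b966bf16da27706e, §1 row (b) / WALL-TABLE.md row 2 sub-rows 2a–2e): statements and bookkeeping only —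
nothing asserted, nothing booked, no named fact, no published theorem restated. Row 2 of the closed
list of `Rank1Residual/WAll/Target.lean` is `WAllExclAdditive` ("non-CM, `p` odd ADDITIVE, `r ≤ 1` ⇒
`BSD(E,p)`"). The tree already PARTITIONS the odd additive locus (`Additive/SharpenedStatements.lean`
`sub_exhaustive`; `Additive/PotSupersingularClasses.lean` `addv_odd_cells`, cell `b2b-bsdres` lane
CLASS-CLOSURE) into the census cells

* **(M)** potentially multiplicative (`Additive.SubM W p`: `ord_p j < 0`) — WALL-TABLE 2e; routes K1
  `AdditiveBranchIMC` (item MultLower), dir `Rank1Residual/AdditivePotMult/`;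
* **(G-ord)** Delbourgo's (G) with potentially good ORDINARY reduction (`Additive.SubGordOrd W p`) —
  2a; rung K1 (`Additive.AdditiveOrdinaryLowerHalf`, `N10.LowerHalf*`), W2 Kim-at-3 inside it at `p = 3`;
* **O5** TAME potentially SUPERSINGULAR = `(G) ∧ ss` ∪ `(t′)` (`Additive.ClassO5 W p`) — 2b (quadratic
  branch `e = 2`, rung K8 `O5SharpGss`) and 2c (tame `t′`, rung K8 `O5SharpTprime`); class target of
  record `Additive.O5.Statement` (BSDp-shaped, CM not excluded);
* **O6** WILD (`Additive.ClassO6 W p`; forces `p = 3`, `ClassO6.p_eq_three`) — 2d; rung K9 `O6Sharp`;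
  class target of record `Additive.O6.Statement`.

This file types ONE sub-`Prop` of `WAllExclAdditive` per cell (non-CM, `r ≤ 1`, BSDp-shaped, the
weakest sufficient form), splits O5 further into `(G) ∧ ss` / `(t′)`, PROVES the glue
`WAllExclAdditive ↔ (M) ∧ (G-ord) ∧ O5 ∧ O6` from `addv_odd_cells` (no mathematics), and records the
one-line closers from the cell's existing BSDp-shaped class targets `O5.Statement` / `O6.Statement`
(which are STRONGER: they include CM pairs, covered or `CornerF` in W-ALL). Sub-rows 2f (Kim-at-3
block) and 2g (X3 = reducible) cut across these cells and are the sub-Props `WAllExclX3` /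
`WAllExclX4` of `Target.lean` intersected with them; rank splits (`r = 0` / `r = 1`, as the K1 / K8 t′
/ K9 routes cut) are stated inline by the closers (seat `bsd-wall-ty-2`), not as further defs.

References: `Rank1Residual/WAll/Target.lean` (the closed list), `Rank1Residual/WAll/Conjunction.lean`;
`Additive/SharpenedStatements.lean` §1 (cells (M)/(G)/(t′)/(w)), `Additive/PotSupersingularClasses.lean`
(`SubGordOrd`, `SubGss`, `ClassO5`, `ClassO6`, `addv_odd_cells`), `Additive/PotSupersingularTargets.lean`
(`O5.Statement`, `O6.Statement`); [cite: Delbourgo1998, §1.5 (G) and Thm. 1] (the type (G)/(M)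
vocabulary); [cite: Miller2011LMS, §1 and Def. 1.1] (the currency).
-/

noncomputable section

open scoped Classical

open WeierstrassCurve Literature.NumberTheory.EllipticCurves
  Literature.NumberTheory.EllipticCurves.Rank1Residual Literature.NumberTheory.EllipticCurves.ModularForms
open Summit.BirchSwinnertonDyer.Rank1Residual

set_option autoImplicit false

namespace Summit.BirchSwinnertonDyer

/-! ### Row 2 refined: one sub-`Prop` per census cell of the odd additive locus -/

/-- **Row 2e — potentially multiplicative additive primes (OPEN).** Non-CM `E/ℚ` (globally minimal
`W`), `p` odd additive with `ord_p j(E) < 0` (census cell (M), `Additive.SubM`; Kodaira `I_n^*`,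
a ramified quadratic twist of a Tate curve), `r ≤ 1` ⇒ `BSD(E,p)`. [folklore] -/
@[conjecture] def WAllExclAddPotMult : Prop :=
  ∀ (W : WeierstrassCurve ℚ) [W.IsElliptic] [W.IsGloballyMinimal] (p : ℕ) [Fact p.Prime],
    ¬ W.HasCM → p ≠ 2 → Addv W p → Additive.SubM W p → W.analyticRank ≤ 1 → BSDp W p

/-- **Row 2a — potentially good ORDINARY additive primes of Delbourgo's type (G) (OPEN).** Non-CM,
`p` odd additive, census cell (G-ord) (`Additive.SubGordOrd`: `ord_p j ≥ 0`, `f_p = 2`, `e ∣ p − 1`,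
ordinary over the semistabilising subfield of `ℚ(ζ_p)`), `r ≤ 1` ⇒ `BSD(E,p)`.
[cite: Delbourgo1998, §1.5 (G) and Thm. 1] -/
@[conjecture] def WAllExclAddPotOrd : Prop :=
  ∀ (W : WeierstrassCurve ℚ) [W.IsElliptic] [W.IsGloballyMinimal] (p : ℕ) [Fact p.Prime],
    ¬ W.HasCM → p ≠ 2 → Addv W p → Additive.SubGordOrd W p → W.analyticRank ≤ 1 → BSDp W p

/-- **Rows 2b ∪ 2c — TAME potentially SUPERSINGULAR additive primes, class O5 (OPEN).** Non-CM,
`Additive.ClassO5 W p` (`p` odd additive, `(G) ∧ ss` or `(t′)`), `r ≤ 1` ⇒ `BSD(E,p)`. The cell's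
class target `Additive.O5.Statement` (CM included) closes it (`wAllExclAddTameSS_of_statement`).
[folklore] -/
@[conjecture] def WAllExclAddTameSS : Prop :=
  ∀ (W : WeierstrassCurve ℚ) [W.IsElliptic] [W.IsGloballyMinimal] (p : ℕ) [Fact p.Prime],
    ¬ W.HasCM → Additive.ClassO5 W p → W.analyticRank ≤ 1 → BSDp W p

/-- Row 2b — the quadratic branch `(G) ∧ ss` (OPEN): non-CM, `p` odd additive, `Additive.SubGss W p`
(type (G), NOT potentially ordinary; then `e = 2`, Kodaira `I₀*`, `E` = the `χ_{p*}`-twist of a good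
supersingular curve), `r ≤ 1` ⇒ `BSD(E,p)`. Rung K8 (`O5SharpGss`). [folklore] -/
@[conjecture] def WAllExclAddGss : Prop :=
  ∀ (W : WeierstrassCurve ℚ) [W.IsElliptic] [W.IsGloballyMinimal] (p : ℕ) [Fact p.Prime],
    ¬ W.HasCM → p ≠ 2 → Addv W p → Additive.SubGss W p → W.analyticRank ≤ 1 → BSDp W p

/-- Row 2c — the tame branch `(t′)` (OPEN): non-CM, `p` odd additive, `Additive.SubTprime W p`
(`ord_p j ≥ 0`, `f_p = 2`, `e ∤ p − 1`), `r ≤ 1` ⇒ `BSD(E,p)`. Rung K8 t′ (`O5SharpTprime`). [folklore] -/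
@[conjecture] def WAllExclAddTprime : Prop :=
  ∀ (W : WeierstrassCurve ℚ) [W.IsElliptic] [W.IsGloballyMinimal] (p : ℕ) [Fact p.Prime],
    ¬ W.HasCM → p ≠ 2 → Addv W p → Additive.SubTprime W p → W.analyticRank ≤ 1 → BSDp W p

/-- **Row 2d — WILD additive primes, class O6 (OPEN).** Non-CM, `Additive.ClassO6 W p` (`p` odd
additive, `ord_p j ≥ 0`, `f_p ≠ 2`; forces `p = 3`, `v₃(N) ∈ {3,4,5}`), `r ≤ 1` ⇒ `BSD(E,p)`. The
cell's class target `Additive.O6.Statement` closes it (`wAllExclAddWild_of_statement`). Rung K9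
(`O6Sharp`). [folklore] -/
@[conjecture] def WAllExclAddWild : Prop :=
  ∀ (W : WeierstrassCurve ℚ) [W.IsElliptic] [W.IsGloballyMinimal] (p : ℕ) [Fact p.Prime],
    ¬ W.HasCM → Additive.ClassO6 W p → W.analyticRank ≤ 1 → BSDp W p

/-! ### Glue (no mathematics: `addv_odd_cells`, `ClassO5 = p odd ∧ additive ∧ (Gss ∨ t′)`) -/

/-- **Row 2 = (M) ∧ (G-ord) ∧ O5 ∧ O6**: the odd additive locus is the union of the four census
cells (`Additive.addv_odd_cells`), so `WAllExclAdditive` is exactly the conjunction of the four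
sub-`Prop`s. [folklore] -/
theorem wAllExclAdditive_iff_cells :
    WAllExclAdditive ↔
      WAllExclAddPotMult ∧ WAllExclAddPotOrd ∧ WAllExclAddTameSS ∧ WAllExclAddWild := by
  constructor
  · intro h
    exact ⟨fun W _ _ p _ hcm hp hadd _ hr ↦ h W p hcm hp hadd hr,
      fun W _ _ p _ hcm hp hadd _ hr ↦ h W p hcm hp hadd hr,
      fun W _ _ p _ hcm hO hr ↦ h W p hcm hO.1 hO.2.1 hr,
      fun W _ _ p _ hcm hO hr ↦ h W p hcm hO.1 hO.2.1 hr⟩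
  · rintro ⟨hM, hG, h5, h6⟩ W _ _ p _ hcm hp hadd hr
    rcases Additive.addv_odd_cells W p hp hadd with h | h | h | h
    · exact hM W p hcm hp hadd h hr
    · exact hG W p hcm hp hadd h hr
    · exact h5 W p hcm h hr
    · exact h6 W p hcm h hr

/-- **O5 = `(G) ∧ ss` ∪ `(t′)`**: `WAllExclAddTameSS ↔ WAllExclAddGss ∧ WAllExclAddTprime`. [folklore] -/
theorem wAllExclAddTameSS_iff : WAllExclAddTameSS ↔ WAllExclAddGss ∧ WAllExclAddTprime := by
  constructor
  · intro h
    exact ⟨fun W _ _ p _ hcm hp hadd hs hr ↦ h W p hcm ⟨hp, hadd, Or.inl hs⟩ hr,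
      fun W _ _ p _ hcm hp hadd ht hr ↦ h W p hcm ⟨hp, hadd, Or.inr ht⟩ hr⟩
  · rintro ⟨hs, ht⟩ W _ _ p _ hcm hO hr
    obtain ⟨hp, hadd, h⟩ := hO
    rcases h with h | h
    · exact hs W p hcm hp hadd h hr
    · exact ht W p hcm hp hadd h hr

/-- The wild sub-class lives at `p = 3` only (`Additive.ClassO6.p_eq_three`): `WAllExclAddWild` is a
statement about `BSD(E,3)`. [folklore] -/
theorem wAllExclAddWild_iff_three :
    WAllExclAddWild ↔
      ∀ (W : WeierstrassCurve ℚ) [W.IsElliptic] [W.IsGloballyMinimal],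
        ¬ W.HasCM → Additive.ClassO6 W 3 → W.analyticRank ≤ 1 → BSDp W 3 := by
  constructor
  · intro h W _ _ hcm hO hr
    exact h W 3 hcm hO hr
  · intro h W _ _ p _ hcm hO hr
    obtain rfl := Additive.ClassO6.p_eq_three hO
    exact h W hcm hO hr

/-! ### Closers of record from the cell's class targets, and the converse from W-ALL -/

/-- The class target `Additive.O5.Statement` (all curves) closes the tame supersingular sub-row. [folklore] -/
theorem wAllExclAddTameSS_of_statement (h : Additive.O5.Statement) : WAllExclAddTameSS :=
  fun W _ _ p _ _ hO hr ↦ h W p hr hO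

/-- The class target `Additive.O6.Statement` (all curves) closes the wild sub-row. [folklore] -/
theorem wAllExclAddWild_of_statement (h : Additive.O6.Statement) : WAllExclAddWild :=
  fun W _ _ p _ _ hO hr ↦ h W p hr hO

/-- Every additive sub-row follows from `WAll`. [folklore] -/
theorem wAllExclAdd_cells_of_wAll (h : WAll) :
    WAllExclAddPotMult ∧ WAllExclAddPotOrd ∧ WAllExclAddTameSS ∧ WAllExclAddWild ∧
      WAllExclAddGss ∧ WAllExclAddTprime := by
  obtain ⟨hM, hG, h5, h6⟩ := wAllExclAdditive_iff_cells.1 (wAllExclusions_of_wAll h).2.1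
  exact ⟨hM, hG, h5, h6, wAllExclAddTameSS_iff.1 h5⟩

end Summit.BirchSwinnertonDyer

end
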